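import Summits.QuantumAdvantage.QuantumAdvantage.Theorems.LivenessSeparationLaw
import Summits.QuantumAdvantage.QuantumAdvantage.Theorems.LivenessSeparationLawC
import Summits.QuantumAdvantage.QuantumAdvantage.Theorems.LivenessSeparationLawD

set_option linter.dupNamespace false

/-!
# LIVENESS SEPARATION, part I (lens 4, g28 cycle 4b) — the ENDS configuration: merge law ∘ two-label rectangle kill

Blocker `X = AbsorptionDial.NoPerfectPolyOdd` (item 28487); rung-2 piece `TwoQuadNoPerfectOdd`, ENDS configuration (NODE-g28 §5e, (P3)₂ of claim T2′).
Composition of part G (`merge`, `loss_of_merge_loss`, part E `coLive_ends`) with part H (`loss_of_twoLabelRectangle`): registers `k`-form except two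
CO-LIVE registers `g₀ ≠ g₁` (live at exactly the same inputs — for the END cuts `0`, `n` this is `n ≡ c (mod 3)`); if on some disjoint-support
rectangle with columns indexed by all pairs `(w¹,w²) ∈ 𝔽_p^{r+1} × 𝔽_p^{r+1}` the cut `g₀` is live and the XOR of the two registers fires as a
row-dependent non-constant two-label table `G_i(⟨(1,a_i), N₁w¹ + w₁⟩, ⟨(1,a_i), N₂w² + w₂⟩)`, `a` injective, `|ι| > (n+1)·2p^k + 1`, then the
strategy loses somewhere (`loss_of_twoLabelRectangle_merge`; `loss_of_twoLabelRectangle_ends` for the cuts `0`, `n`).  No new arithmetic.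
-/

open Finset
open Summit.QuantumAdvantage.AdviceFreeQNC0
open Summit.QuantumAdvantage.QuantumAdvantage.Theorems.InnerDegreeDial

namespace Summit.QuantumAdvantage.QuantumAdvantage.Theorems.LivenessSeparation

variable {p : ℕ} [Fact p.Prime] {n : ℕ}

/-- **TWO CO-LIVE REGISTERS, rectangle kill.**  Registers `k`-form except `g₀ ≠ g₁`, which are live at the same inputs; a disjoint-support
rectangle (rows `X i`, columns `Y (w¹,w²)` over ALL pairs) on which `g₀` is live and `y g₀ ⊕ y g₁` is the two-label family pattern
`G_i(⟨(1,a_i), N₁w¹ + w₁⟩, ⟨(1,a_i), N₂w² + w₂⟩)` (`a` injective, every `G_i` non-constant) with `|ι| > (n+1)·2p^k + 1` forces a losing input: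
the merged strategy (part G) is `k`-form except `g₀` and loses by part H, and it wins exactly where `y` wins. -/
theorem loss_of_twoLabelRectangle_merge (hp5 : 5 ≤ p) {k r : ℕ} {ι : Type*} [Fintype ι] (c : ℕ)
    (y : Fin (n + 1) → (Fin n → Bool) → Bool) (g₀ g₁ : Fin (n + 1)) (hg : g₀ ≠ g₁)
    (hco : ∀ u, liveCut c u g₀ = liveCut c u g₁)
    (lam : Fin (n + 1) → Fin k → Fin n → ZMod p) (F : Fin (n + 1) → (Fin k → ZMod p) → Bool)
    (hF : ∀ g, g ≠ g₀ → g ≠ g₁ → ∀ u, y g u = F g (fun j => ∑ i, if u i = true then lam g j i else 0))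
    (X : ι → Fin n → Bool) (Y : (Fin (r + 1) → ZMod p) × (Fin (r + 1) → ZMod p) → Fin n → Bool)
    (hd : ∀ i w l, ¬ (X i l = true ∧ Y w l = true))
    (G : ι → ZMod p → ZMod p → Bool) (hG : ∀ i, ∃ b₁ b₂ b₁' b₂', G i b₁ b₂ ≠ G i b₁' b₂')
    (a : ι → Fin r → ZMod p) (ha : Function.Injective a) (w₁ w₂ : Fin (r + 1) → ZMod p)
    (N₁ N₁' N₂ N₂' : Matrix (Fin (r + 1)) (Fin (r + 1)) (ZMod p)) (hN₁ : N₁ * N₁' = 1) (hN₂ : N₂ * N₂' = 1)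
    (hpat : ∀ i w, xor (y g₀ (bor (X i) (Y w))) (y g₁ (bor (X i) (Y w)))
      = G i (lineRep p r (a i) ⬝ᵥ (N₁.mulVec w.1 + w₁)) (lineRep p r (a i) ⬝ᵥ (N₂.mulVec w.2 + w₂)))
    (hlive : ∀ i w, liveCut c (bor (X i) (Y w)) g₀ = true)
    (ht : (n + 1) * (p ^ k * 2) + 1 < Fintype.card ι) :
    ∃ u, ringWinU c y u = false := by
  classical
  refine loss_of_merge_loss c y hg hco ?_
  refine loss_of_twoLabelRectangle hp5 c (merge y g₀ g₁) g₀ lam (Function.update F g₁ fun _ => false) ?_ X Y hd G hG a ha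
    w₁ w₂ N₁ N₁' N₂ N₂' hN₁ hN₂ ?_ hlive ht
  · intro g hg₀ u
    by_cases hg₁ : g = g₁
    · subst hg₁
      rw [merge_snd y hg, Function.update_self]
    · rw [merge_of_ne y hg₀ hg₁, Function.update_of_ne hg₁]
      exact hF g hg₀ hg₁ u
  · intro i w
    rw [merge_fst]
    exact hpat i w

/-- **THE ENDS CONFIGURATION ((P3)₂ of NODE-g28 §5e).**  `n ≡ c (mod 3)`, `n ≥ 1`: the END cuts `0` and `n` are co-live (part E `coLive_ends`),
so registers `k`-form except the two ends + a two-label family-pattern rectangle for `y 0 ⊕ y n` of size `> (n+1)·2p^k + 1` ⇒ a losing input. -/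
theorem loss_of_twoLabelRectangle_ends (hp5 : 5 ≤ p) {k r : ℕ} {ι : Type*} [Fintype ι] (c : ℕ) (hn : n % 3 = c % 3) (hn0 : 0 < n)
    (y : Fin (n + 1) → (Fin n → Bool) → Bool)
    (lam : Fin (n + 1) → Fin k → Fin n → ZMod p) (F : Fin (n + 1) → (Fin k → ZMod p) → Bool)
    (hF : ∀ g : Fin (n + 1), g ≠ 0 → g ≠ Fin.last n → ∀ u, y g u = F g (fun j => ∑ i, if u i = true then lam g j i else 0))
    (X : ι → Fin n → Bool) (Y : (Fin (r + 1) → ZMod p) × (Fin (r + 1) → ZMod p) → Fin n → Bool)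
    (hd : ∀ i w l, ¬ (X i l = true ∧ Y w l = true))
    (G : ι → ZMod p → ZMod p → Bool) (hG : ∀ i, ∃ b₁ b₂ b₁' b₂', G i b₁ b₂ ≠ G i b₁' b₂')
    (a : ι → Fin r → ZMod p) (ha : Function.Injective a) (w₁ w₂ : Fin (r + 1) → ZMod p)
    (N₁ N₁' N₂ N₂' : Matrix (Fin (r + 1)) (Fin (r + 1)) (ZMod p)) (hN₁ : N₁ * N₁' = 1) (hN₂ : N₂ * N₂' = 1)
    (hpat : ∀ i w, xor (y 0 (bor (X i) (Y w))) (y (Fin.last n) (bor (X i) (Y w)))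
      = G i (lineRep p r (a i) ⬝ᵥ (N₁.mulVec w.1 + w₁)) (lineRep p r (a i) ⬝ᵥ (N₂.mulVec w.2 + w₂)))
    (hlive : ∀ i w, liveCut c (bor (X i) (Y w)) 0 = true)
    (ht : (n + 1) * (p ^ k * 2) + 1 < Fintype.card ι) :
    ∃ u, ringWinU c y u = false :=
  loss_of_twoLabelRectangle_merge hp5 c y 0 (Fin.last n)
    (Fin.ne_of_val_ne (by simp only [Fin.val_zero, Fin.val_last]; omega)) (fun u => coLive_ends c hn u)
    lam F hF X Y hd G hG a ha w₁ w₂ N₁ N₁' N₂ N₂' hN₁ hN₂ hpat hlive ht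

end Summit.QuantumAdvantage.QuantumAdvantage.Theorems.LivenessSeparation
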